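import Literature.NumberTheory.ComplexMultiplication.CMTypeRankReflexDegreeComplex
import Literature.AlgebraicGeometry.Pohlmann1968.CMFamilyRankPartitionSlots
import HarnessLib

/-!
# CM types with a SPECIAL ELEMENT over an imaginary quadratic subfield (unitary signature `(n − 1, 1)`):
# the reflex field is `φ^sp(K)`, a conjugate of `K` (Howard 2012, §3.1); sextic CM fields: DIS Props. 16 & 18

Layer `Literature/NumberTheory/ComplexMultiplication`, namespace `Literature.NumberTheory.ComplexMultiplication` (lane
`lit-hodgefound`, Track 2 foundations, Layer A3; seat `lit-hodgefound-p11`, generation 25, row g25-#6).  Sequel of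
`CMTypeRankReflexDegreeComplex` (g25-#5), `SexticPrimitiveCMTypesGaloisEquivalent` (g25-#1) and
`CMTypeGaloisClassReflexDegree` (g24-#6).  THEOREMS ONLY: no definition, no named fact (D-0026), net Literature debt 0.

THE PRINT.  B. Howard, *Complex multiplication cycles and Kudla–Rapoport divisors*, Ann. of Math. 176 (2012)
[Howard2012], §3.1 (held `paper:arxiv-1303.0545`, p0019; also §2.3, p0013), for a CM field `K ⊇ K₀`, `K₀` imaginary
quadratic with a fixed embedding `ι : K₀ → ℂ`:

> «`Φ` is a CM type of `K` of signature `(n−1,1)`; this means there is a unique `φ^sp ∈ Φ` whose restriction to `K₀`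
> is `ῑ : K₀ → ℂ` […] The CM type `Φ` is uniquely determined by its special element `φ^sp`, and thus `σ ∈ Aut(ℂ/K₀)`
> fixes `Φ` if and only if it fixes `φ^sp`.  It follows that `φ^sp(K) ⊂ K_Φ`» (`K_Φ ⊂ ℂ` any finite extension of `K₀`
> containing the reflex field of `Φ`) «and that we may take `K_Φ = φ^sp(K)` if we choose.»

B. Dina, S. Ionica, J. Sijsling, *Isogenous hyperelliptic and non-hyperelliptic Jacobians with maximal complex
multiplication* (2022) [DinaIonicaSijsling2022], §1.3 (held `paper:arxiv-2104.04919`, p. 8), for SEXTIC CM fields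
with Galois group `C₆` (Prop. 16: «We have `(K^r, Φ^r) = (K, Φ)` for all primitive CM types `Φ`») and `D₆` (Prop. 18:
«`(K₁^r, Φ₁^r) = (K, Φ)`, `(K₂^r, Φ₂^r) = (σ(K), Φσ⁻¹)`, `(K₃^r, Φ₃^r) = (σ⁻¹(K), Φσ)`» — the reflex field of a
primitive type is a CONJUGATE of `K`); G. Shimura (1998) [Shimura1998], §8.3 Prop. 28 (the reflex field
`K* = ℚ(tr_Φ(K)) ⊂ ℂ` and its characterisation by the stabiliser of `Φ`).

THE TREE'S MODEL.  `K` is a CM field (`IsCMField K`), `k₀ : IntermediateField ℚ K` an imaginary quadratic subfield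
(`finrank ℚ k₀ = 2`, `IsTotallyComplex k₀`), `Φ : CMType K` a complex CM type, and `Aut(ℂ)` acts on `Hom(K, ℂ)` by
composition (`τ • φ`, `EmbeddingAction`); the reflex field is the tree's `traceField Φ = ℚ(tr_Φ(K)) ≤ ℂ` with
`τΦ = Φ ⟺ τ|_{K*} = id` (`forall_smul_mem_iff_iff_forall_apply_traceField_eq`).  Howard's «special element» of
`Φ` is an embedding `σ₀ ∈ Φ` which is the ONLY member of `Φ` above its own restriction `σ₀|_{k₀}`; we spell this out as
the pair of hypotheses `σ₀ ∈ Φ.1`, `∀ φ ∈ Φ.1, φ|_{k₀} = σ₀|_{k₀} → φ = σ₀` (no new definition), and write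
`φ|_{k₀} = φ.comp (algebraMap k₀ K)`.  Then `Φ` has `n − 1` members above `\overline{σ₀|_{k₀}}` and one above
`σ₀|_{k₀}`: signature `(n − 1, 1)`, `2n = [K : ℚ]`.

WHAT IS PROVED (all `sorry`-free).

§1 (any degree) `mem_iff_of_special` — the NORMAL FORM «`φ ∈ Φ ⟺ φ = σ₀ ∨ (φ|_{k₀} ≠ σ₀|_{k₀} ∧ φ ≠ σ̄₀)`» («this
   element determines `Φ` uniquely»: `eq_of_special`); `exists_special` (every embedding is the special element of a
   CM type); `special_cmTypeSmul` (`τσ₀` is the special element of `τΦ`).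
§2 (any degree) HOWARD'S LEMMA `smul_mem_iff_of_smul_special_eq` — an automorphism of `ℂ` fixing `σ₀` fixes `Φ` — and
   its reflex-field form **`traceField_le_fieldRange_of_special`: `K* ⊆ σ₀(K)`** («`φ^sp(K)` contains the reflex
   field», i.e. one «may take `K_Φ = φ^sp(K)`»).
§3 (`[K : ℚ] ≥ 6`, i.e. `n ≥ 3`) the converse `smul_special_eq_of_forall_smul_mem_iff` — `τΦ = Φ ⟹ τσ₀ = σ₀` (no
   hypothesis `τ ∈ Aut(ℂ/K₀)` is needed once `n ≥ 3`) —, so `Stab(Φ) = Aut(ℂ/σ₀(K))` and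
   **`traceField_eq_fieldRange_of_special`: `K* = σ₀(K)`**, `[K* : ℚ] = [K : ℚ]`, **`K* ≅ K`**
   (`nonempty_ringEquiv_traceField_of_special`); the special element is unique (`special_unique`); a type with a
   special element is PRIMITIVE (`isPrimitive_of_special`, through the separation criterion
   `isPrimitive_iff_forall_eq`); the types with a special element form ONE Galois class
   (`galoisRel_iff_exists_special`) with exactly `[K : ℚ]` members (`natCard_galoisClass_eq_finrank_of_special`,
   `natCard_special_eq_finrank`).  (For `n = 2`, `K ⊇ k₀` quartic, every type has two special elements and is induced
   from the other imaginary quadratic subfield: the bound `n ≥ 3` is sharp.)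
§4 SEXTIC `K ⊇ k₀` (`C₆` and `D₆` uniformly, no hypothesis on the Galois group): a CM type is primitive iff it has a
   special element (`isPrimitive_iff_exists_special_sextic`; the imprimitive types are the two induced from `k₀`,
   g25-#1), hence **DIS Props. 16 & 18: the reflex field of every PRIMITIVE CM type of a sextic CM field containing an
   imaginary quadratic field is a conjugate `σ₀(K) = τ(φ(K)) ⊂ ℂ` of `K`, and `K* ≅ K`**
   (`exists_traceField_eq_fieldRange_of_isPrimitive_sextic`, `exists_traceField_eq_smul_fieldRange_of_isPrimitive_sextic`,
   `nonempty_ringEquiv_traceField_of_isPrimitive_sextic`).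
§5 OCTIC `K ⊇ k₀`: the `8` types with a special element are primitive, Galois equivalent, with `K* ≅ K` of degree `8`.

NOT here: the reflex TYPE `Φ^r` on `σ₀(K)` (DIS: `Φσ⁻¹`); Howard's `p`-adic version (§2.3); the nondegeneracy of
types with a special element (Dodson 1984 §3.1.1, weight one) — a sequel.

## References

* [Howard2012] B. Howard, *Complex multiplication cycles and Kudla–Rapoport divisors*, Ann. of Math. (2) 176 (2012)
  1097–1171, §3.1 (and §2.3).
* [DinaIonicaSijsling2022] B. Dina, S. Ionica, J. Sijsling (2022), §1.3 Def. 15, Props. 16, 17, 18.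
* [Shimura1998] G. Shimura, *Abelian Varieties with Complex Multiplication and Modular Functions* (1998), §8.3
  Prop. 28, §8.4 Example (1).

## Provenance

Lane `lit-hodgefound` (HOME `run/shared/lean/pub/lit-hodgefound/`), prover seat `lit-hodgefound-p11` (gen 25),
self-proposed row g25-#6 (INBOX claim 2026-08-27, l.40929).
-/

set_option autoImplicit false

noncomputable section

open scoped Classical NumberField Pointwise
open NumberField Module IntermediateField

namespace Literature.NumberTheory.ComplexMultiplication

open Literature.AlgebraicGeometry.Motives (CMType)
open Literature.AlgebraicGeometry.Motives.HodgeStructure (cmTypeSmul cmTypeSmul_val)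
open Literature.AlgebraicGeometry.Pohlmann1968 (isPretransitive_ringEquiv_complex card_fibre_eq_finrank)

variable {K : Type} [Field K] [NumberField K]

/-! ## §0 Preliminaries: the two embeddings of an imaginary quadratic subfield; restriction and the action -/

section Prelim

variable (k₀ : IntermediateField ℚ K)

/-- `(τφ)|_{k₀} = τ(φ|_{k₀})`. [folklore] -/
private theorem smul_comp_sp (τ : ℂ ≃+* ℂ) (φ : K →+* ℂ) :
    (τ • φ).comp (algebraMap k₀ K) = τ • φ.comp (algebraMap k₀ K) :=
  RingHom.ext fun _ => rfl

/-- `φ̄|_{k₀} = \overline{φ|_{k₀}}`. [folklore] -/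
private theorem conjugate_comp_sp (φ : K →+* ℂ) :
    (ComplexEmbedding.conjugate φ).comp (algebraMap k₀ K) = ComplexEmbedding.conjugate (φ.comp (algebraMap k₀ K)) :=
  (conjugate_comp_ringHom (algebraMap k₀ K) φ).symm

variable [IsTotallyComplex k₀]

/-- `ῑ ≠ ι` for an embedding `ι` of the totally complex `k₀`. [folklore] -/
private theorem conjugate_ne_sp (ψ : k₀ →+* ℂ) : ComplexEmbedding.conjugate ψ ≠ ψ := fun h =>
  IsTotallyComplex.complexEmbedding_not_isReal ψ (ComplexEmbedding.isReal_iff.2 h)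

/-- **`[k₀ : ℚ] = 2`: every complex embedding of `k₀` is `ι` or `ῑ`.** [cite: Shimura1998, §8.4 (1)] -/
private theorem eq_or_eq_conjugate_sp (hk₀ : finrank ℚ k₀ = 2) (ψ χ : k₀ →+* ℂ) :
    χ = ψ ∨ χ = ComplexEmbedding.conjugate ψ := by
  haveI : NumberField k₀ := NumberField.mk
  have hne : ψ ≠ ComplexEmbedding.conjugate ψ := fun h => conjugate_ne_sp k₀ ψ h.symm
  have hcard : ({ψ, ComplexEmbedding.conjugate ψ} : Finset (k₀ →+* ℂ)).card = Fintype.card (k₀ →+* ℂ) := by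
    rw [Finset.card_pair hne, Embeddings.card, hk₀]
  have hχ : χ ∈ ({ψ, ComplexEmbedding.conjugate ψ} : Finset (k₀ →+* ℂ)) := by
    rw [Finset.eq_univ_of_card _ hcard]
    exact Finset.mem_univ χ
  simpa only [Finset.mem_insert, Finset.mem_singleton] using hχ

omit [IsTotallyComplex k₀] in
/-- **`[K : ℚ] ≥ 6`: above every embedding of the quadratic `k₀` lie at least three embeddings of `K`**, so two of them
avoid any given one (`|fibre| = [K : k₀] = [K : ℚ]/2`, the tree's `card_fibre_eq_finrank`). [cite: Howard2012, §3.1] -/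
private theorem exists_two_fibre_sp (hk₀ : finrank ℚ k₀ = 2) (h6 : 6 ≤ finrank ℚ K) (ψ : k₀ →+* ℂ) (e : K →+* ℂ) :
    ∃ χ₁ χ₂ : K →+* ℂ, χ₁.comp (algebraMap k₀ K) = ψ ∧ χ₂.comp (algebraMap k₀ K) = ψ ∧ χ₁ ≠ χ₂ ∧ χ₁ ≠ e ∧ χ₂ ≠ e := by
  classical
  set F := Finset.univ.filter fun φ : K →+* ℂ => φ.comp (algebraMap k₀ K) = ψ with hF
  have hcard : F.card = finrank k₀ K := card_fibre_eq_finrank (K := K) (k := k₀) ψ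
  have htower := Module.finrank_mul_finrank ℚ k₀ K
  rw [hk₀] at htower
  have h3 : 3 ≤ F.card := by rw [hcard]; omega
  have h2 : 1 < (F.erase e).card := by
    have := Finset.pred_card_le_card_erase (s := F) (a := e)
    omega
  obtain ⟨χ₁, h₁, χ₂, h₂, hne⟩ := Finset.one_lt_card.1 h2
  rw [Finset.mem_erase] at h₁ h₂
  exact ⟨χ₁, χ₂, (Finset.mem_filter.1 h₁.2).2, (Finset.mem_filter.1 h₂.2).2, hne, h₁.1, h₂.1⟩

end Prelim

section CM

variable [IsCMField K]

/-- `τφ̄ = \overline{τφ}`: complex conjugation commutes with `Aut(ℂ)` on the embeddings of a CM field.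
[cite: Shimura1998, §18.2 Lemma (i)] -/
private theorem smul_conjugate_sp (τ : ℂ ≃+* ℂ) (φ : K →+* ℂ) :
    τ • ComplexEmbedding.conjugate φ = ComplexEmbedding.conjugate (τ • φ) := by
  refine RingHom.ext fun x => ?_
  change τ (starRingEnd ℂ (φ x)) = starRingEnd ℂ (τ (φ x))
  rw [← IsCMField.complexEmbedding_complexConj K φ x]
  exact IsCMField.complexEmbedding_complexConj K ((τ : ℂ →+* ℂ).comp φ) x

omit [IsCMField K] in
/-- The image of an embedding of a number field is finite over `ℚ`. [folklore] -/
private theorem finiteDimensional_fieldRange_sp (s : K →+* ℂ) : FiniteDimensional ℚ s.toRatAlgHom.fieldRange :=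
  LinearEquiv.finiteDimensional (AlgEquiv.ofInjectiveField s.toRatAlgHom).toLinearEquiv

omit [IsCMField K] in
/-- `[s(K) : ℚ] = [K : ℚ]`. [folklore] -/
private theorem finrank_fieldRange_sp (s : K →+* ℂ) : finrank ℚ s.toRatAlgHom.fieldRange = finrank ℚ K := by
  rw [← IntermediateField.finrank_eq_finrank_subalgebra, AlgHom.fieldRange_toSubalgebra]
  exact (AlgEquiv.ofInjectiveField s.toRatAlgHom).toLinearEquiv.finrank_eq.symm

omit [IsCMField K] in
/-- An embedding `s : K → ℂ` corestricted to a subfield `F ⊆ ℂ` EQUAL to its image is an isomorphism `K ≃ F`. [folklore] -/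
private theorem nonempty_ringEquiv_of_eq_fieldRange_sp {F : IntermediateField ℚ ℂ} (s : K →+* ℂ)
    (hF : F = s.toRatAlgHom.fieldRange) : Nonempty (K ≃+* F) := by
  have hmem : ∀ y : K, s y ∈ F := fun y => by rw [hF]; exact ⟨y, rfl⟩
  let g : K →+* F := s.codRestrict F hmem
  refine ⟨RingEquiv.ofBijective g ⟨g.injective, fun z => ?_⟩⟩
  have hz : (z : ℂ) ∈ s.toRatAlgHom.fieldRange := by rw [← hF]; exact z.2
  obtain ⟨y, hy⟩ := AlgHom.mem_fieldRange.1 hz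
  exact ⟨y, Subtype.ext hy⟩

omit [IsCMField K] in
/-- `ℚ(tr_Φ(K))` is a finite extension of `ℚ`. [folklore] -/
private theorem finiteDimensional_traceField_sp (Φ : CMType K) : FiniteDimensional ℚ (traceField Φ) :=
  Module.finite_of_finrank_pos (finrank_traceField_pos Φ)

end CM

/-! ## §1 Types with a special element: normal form, uniqueness, existence, transport (any degree) -/

section Special

variable [IsCMField K] (k₀ : IntermediateField ℚ K) [IsTotallyComplex k₀]

omit [IsCMField K] in
/-- **A member of `Φ` other than the special element `σ₀` lies above `\overline{σ₀|_{k₀}}`** (signature `(n−1, 1)`: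
«there is a unique `φ^sp ∈ Φ` whose restriction to `K₀` is `ῑ`»). [cite: Howard2012, §3.1] -/
theorem comp_eq_conjugate_of_mem_of_ne_special (hk₀ : finrank ℚ k₀ = 2) {Φ : CMType K} {σ₀ : K →+* ℂ}
    (hsp : ∀ φ ∈ Φ.1, φ.comp (algebraMap k₀ K) = σ₀.comp (algebraMap k₀ K) → φ = σ₀) {φ : K →+* ℂ}
    (hφ : φ ∈ Φ.1) (hne : φ ≠ σ₀) :
    φ.comp (algebraMap k₀ K) = ComplexEmbedding.conjugate (σ₀.comp (algebraMap k₀ K)) := by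
  rcases eq_or_eq_conjugate_sp k₀ hk₀ (σ₀.comp (algebraMap k₀ K)) (φ.comp (algebraMap k₀ K)) with h | h
  · exact absurd (hsp φ hφ h) hne
  · exact h

omit [IsCMField K] in
/-- **NORMAL FORM of a CM type with a special element `σ₀`:** `φ ∈ Φ ⟺ φ = σ₀ ∨ (φ|_{k₀} ≠ σ₀|_{k₀} ∧ φ ≠ σ̄₀)` — above
`σ₀|_{k₀}` only `σ₀`, above its conjugate everything except `σ̄₀` («The CM type `Φ` is uniquely determined by its
special element `φ^sp`»). [cite: Howard2012, §3.1] -/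
theorem mem_iff_of_special (hk₀ : finrank ℚ k₀ = 2) {Φ : CMType K} {σ₀ : K →+* ℂ} (hσ₀ : σ₀ ∈ Φ.1)
    (hsp : ∀ φ ∈ Φ.1, φ.comp (algebraMap k₀ K) = σ₀.comp (algebraMap k₀ K) → φ = σ₀) (φ : K →+* ℂ) :
    φ ∈ Φ.1 ↔ φ = σ₀ ∨
      (φ.comp (algebraMap k₀ K) ≠ σ₀.comp (algebraMap k₀ K) ∧ φ ≠ ComplexEmbedding.conjugate σ₀) := by
  constructor
  · intro hφ
    by_cases h : φ = σ₀
    · exact Or.inl h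
    refine Or.inr ⟨fun hc => h (hsp φ hφ hc), fun hc => ?_⟩
    rw [hc] at hφ
    exact (Φ.2 σ₀).1 hσ₀ hφ
  · rintro (rfl | ⟨hne, hbar⟩)
    · exact hσ₀
    by_contra hφ
    have hφbar : ComplexEmbedding.conjugate φ ∈ Φ.1 := by
      by_contra h'
      exact hφ ((Φ.2 φ).2 h')
    have hres : (ComplexEmbedding.conjugate φ).comp (algebraMap k₀ K) = σ₀.comp (algebraMap k₀ K) := by
      rw [conjugate_comp_sp]
      rcases eq_or_eq_conjugate_sp k₀ hk₀ (σ₀.comp (algebraMap k₀ K)) (φ.comp (algebraMap k₀ K)) with h1 | h1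
      · exact absurd h1 hne
      · rw [h1]
        exact ComplexEmbedding.involutive_conjugate _ _
    have h := hsp _ hφbar hres
    apply hbar
    rw [← h]
    exact (ComplexEmbedding.involutive_conjugate K φ).symm

omit [IsCMField K] in
/-- Above `\overline{σ₀|_{k₀}}`, every embedding except `σ̄₀` belongs to `Φ` (the `n − 1` of signature `(n−1,1)`).
[cite: Howard2012, §3.1] -/
theorem mem_of_comp_eq_conjugate_of_ne_special (hk₀ : finrank ℚ k₀ = 2) {Φ : CMType K} {σ₀ : K →+* ℂ}
    (hσ₀ : σ₀ ∈ Φ.1) (hsp : ∀ φ ∈ Φ.1, φ.comp (algebraMap k₀ K) = σ₀.comp (algebraMap k₀ K) → φ = σ₀)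
    {φ : K →+* ℂ} (hres : φ.comp (algebraMap k₀ K) = ComplexEmbedding.conjugate (σ₀.comp (algebraMap k₀ K)))
    (hne : φ ≠ ComplexEmbedding.conjugate σ₀) : φ ∈ Φ.1 :=
  (mem_iff_of_special k₀ hk₀ hσ₀ hsp φ).2 (Or.inr ⟨by rw [hres]; exact conjugate_ne_sp k₀ _, hne⟩)

omit [IsCMField K] in
/-- A NON-member of `Φ` other than `σ̄₀` lies above `σ₀|_{k₀}`. [cite: Howard2012, §3.1] -/
theorem comp_eq_of_not_mem_of_ne_special (hk₀ : finrank ℚ k₀ = 2) {Φ : CMType K} {σ₀ : K →+* ℂ}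
    (hσ₀ : σ₀ ∈ Φ.1) (hsp : ∀ φ ∈ Φ.1, φ.comp (algebraMap k₀ K) = σ₀.comp (algebraMap k₀ K) → φ = σ₀)
    {φ : K →+* ℂ} (hφ : φ ∉ Φ.1) (hne : φ ≠ ComplexEmbedding.conjugate σ₀) :
    φ.comp (algebraMap k₀ K) = σ₀.comp (algebraMap k₀ K) := by
  by_contra h
  exact hφ ((mem_iff_of_special k₀ hk₀ hσ₀ hsp φ).2 (Or.inr ⟨h, hne⟩))

omit [IsCMField K] in
/-- **The special element determines the type**: two CM types with the same special element coincide.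
[cite: Howard2012, §3.1] -/
theorem eq_of_special (hk₀ : finrank ℚ k₀ = 2) {Φ Ψ : CMType K} {σ₀ : K →+* ℂ} (hΦ₀ : σ₀ ∈ Φ.1)
    (hΦ : ∀ φ ∈ Φ.1, φ.comp (algebraMap k₀ K) = σ₀.comp (algebraMap k₀ K) → φ = σ₀) (hΨ₀ : σ₀ ∈ Ψ.1)
    (hΨ : ∀ φ ∈ Ψ.1, φ.comp (algebraMap k₀ K) = σ₀.comp (algebraMap k₀ K) → φ = σ₀) : Φ = Ψ :=
  Subtype.ext <| Set.ext fun φ => by rw [mem_iff_of_special k₀ hk₀ hΦ₀ hΦ φ, mem_iff_of_special k₀ hk₀ hΨ₀ hΨ φ]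

/-- **Every embedding `σ₀ : K → ℂ` is the special element of a (unique) CM type**, namely
`{σ₀} ∪ {φ | φ|_{k₀} = \overline{σ₀|_{k₀}}, φ ≠ σ̄₀}`. [cite: Howard2012, §3.1] -/
theorem exists_special (hk₀ : finrank ℚ k₀ = 2) (σ₀ : K →+* ℂ) :
    ∃ Φ : CMType K, σ₀ ∈ Φ.1 ∧ ∀ φ ∈ Φ.1, φ.comp (algebraMap k₀ K) = σ₀.comp (algebraMap k₀ K) → φ = σ₀ := by
  have hι : ComplexEmbedding.conjugate (σ₀.comp (algebraMap k₀ K)) ≠ σ₀.comp (algebraMap k₀ K) :=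
    conjugate_ne_sp k₀ _
  have hσσ : ComplexEmbedding.conjugate σ₀ ≠ σ₀ := fun h =>
    IsTotallyComplex.complexEmbedding_not_isReal σ₀ (ComplexEmbedding.isReal_iff.2 h)
  let S : Set (K →+* ℂ) := {φ | φ = σ₀ ∨
    (φ.comp (algebraMap k₀ K) ≠ σ₀.comp (algebraMap k₀ K) ∧ φ ≠ ComplexEmbedding.conjugate σ₀)}
  refine ⟨⟨S, fun φ => ?_⟩, Or.inl rfl, fun φ hφ hres => ?_⟩
  · constructor
    · rintro (rfl | ⟨hne, hbar⟩)
      · rintro (h | ⟨_, h⟩)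
        · exact hσσ h
        · exact h rfl
      · rintro (h | ⟨hne', _⟩)
        · apply hbar
          rw [← h]
          exact (ComplexEmbedding.involutive_conjugate K φ).symm
        · apply hne'
          rw [conjugate_comp_sp]
          rcases eq_or_eq_conjugate_sp k₀ hk₀ (σ₀.comp (algebraMap k₀ K)) (φ.comp (algebraMap k₀ K)) with h | h
          · exact absurd h hne
          · rw [h]
            exact ComplexEmbedding.involutive_conjugate _ _
    · intro hnot
      by_cases h1 : φ = σ₀
      · exact Or.inl h1
      refine Or.inr ⟨fun hres => hnot (Or.inr ⟨?_, ?_⟩), fun hbar => hnot (Or.inl ?_)⟩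
      · rw [conjugate_comp_sp, hres]
        exact hι
      · exact fun h => h1 ((ComplexEmbedding.involutive_conjugate K).injective h)
      · rw [hbar]
        exact ComplexEmbedding.involutive_conjugate K σ₀
  · rcases hφ with h | ⟨hne, _⟩
    · exact h
    · exact absurd hres hne

omit [IsTotallyComplex k₀] in
/-- **Transport: `τσ₀` is the special element of `τΦ`** (Howard: «the CM type `Φ^σ` is again of signature `(n−1,1)`»;
DIS Prop. 17: conjugating a type by `σ` conjugates its reflex data). [cite: Howard2012, §2.3]
[cite: DinaIonicaSijsling2022, §1.3 Prop. 17] -/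
theorem special_cmTypeSmul {Φ : CMType K} {σ₀ : K →+* ℂ} (hσ₀ : σ₀ ∈ Φ.1)
    (hsp : ∀ φ ∈ Φ.1, φ.comp (algebraMap k₀ K) = σ₀.comp (algebraMap k₀ K) → φ = σ₀) (τ : ℂ ≃+* ℂ) :
    τ • σ₀ ∈ (cmTypeSmul τ Φ).1 ∧ ∀ φ ∈ (cmTypeSmul τ Φ).1,
      φ.comp (algebraMap k₀ K) = (τ • σ₀).comp (algebraMap k₀ K) → φ = τ • σ₀ := by
  refine ⟨by rw [cmTypeSmul_val]; exact Set.smul_mem_smul_set hσ₀, fun φ hφ hres => ?_⟩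
  rw [cmTypeSmul_val, Set.mem_smul_set_iff_inv_smul_mem] at hφ
  have hres' : (τ⁻¹ • φ).comp (algebraMap k₀ K) = σ₀.comp (algebraMap k₀ K) := by
    rw [smul_comp_sp, hres, smul_comp_sp, inv_smul_smul]
  have h := hsp _ hφ hres'
  rw [← h, smul_inv_smul]

/-! ## §2 Howard's lemma: `Aut(ℂ/σ₀(K)) ≤ Stab(Φ)`, i.e. `K* ⊆ σ₀(K)` (any degree) -/

/-- **HOWARD'S LEMMA: an automorphism of `ℂ` fixing the special element fixes the type** («`σ ∈ Aut(ℂ/K₀)` fixes `Φ`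
if and only if it fixes `φ^sp`», the «if» half, valid in every degree; `τσ₀ = σ₀` says that `τ` is the identity on
`σ₀(K) ⊇ ι(K₀)`). [cite: Howard2012, §3.1] -/
theorem smul_mem_iff_of_smul_special_eq (hk₀ : finrank ℚ k₀ = 2) {Φ : CMType K} {σ₀ : K →+* ℂ} (hσ₀ : σ₀ ∈ Φ.1)
    (hsp : ∀ φ ∈ Φ.1, φ.comp (algebraMap k₀ K) = σ₀.comp (algebraMap k₀ K) → φ = σ₀) {τ : ℂ ≃+* ℂ}
    (hτ : τ • σ₀ = σ₀) (χ : K →+* ℂ) : τ • χ ∈ Φ.1 ↔ χ ∈ Φ.1 := by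
  have hinj : Function.Injective (fun e : K →+* ℂ => τ • e) := MulAction.injective τ
  have hinj₀ : Function.Injective (fun e : k₀ →+* ℂ => τ • e) := MulAction.injective τ
  have h1 : τ • χ = σ₀ ↔ χ = σ₀ := by
    constructor
    · intro h
      exact hinj (h.trans hτ.symm)
    · rintro rfl
      exact hτ
  have h2 : (τ • χ).comp (algebraMap k₀ K) = σ₀.comp (algebraMap k₀ K) ↔
      χ.comp (algebraMap k₀ K) = σ₀.comp (algebraMap k₀ K) := by
    constructor
    · intro h
      rw [smul_comp_sp] at h
      refine hinj₀ (h.trans ?_)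
      change σ₀.comp (algebraMap k₀ K) = τ • σ₀.comp (algebraMap k₀ K)
      rw [← smul_comp_sp, hτ]
    · intro h
      rw [smul_comp_sp, h, ← smul_comp_sp, hτ]
  have h3 : τ • χ = ComplexEmbedding.conjugate σ₀ ↔ χ = ComplexEmbedding.conjugate σ₀ := by
    constructor
    · intro h
      refine hinj (h.trans ?_)
      change ComplexEmbedding.conjugate σ₀ = τ • ComplexEmbedding.conjugate σ₀
      rw [smul_conjugate_sp, hτ]
    · rintro rfl
      rw [smul_conjugate_sp, hτ]
  rw [mem_iff_of_special k₀ hk₀ hσ₀ hsp (τ • χ), mem_iff_of_special k₀ hk₀ hσ₀ hsp χ, h1, Ne, Ne, h2, h3]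

/-- The same in `cmTypeSmul` form: `τσ₀ = σ₀ ⟹ τΦ = Φ`. [cite: Howard2012, §3.1] -/
theorem cmTypeSmul_eq_of_smul_special_eq (hk₀ : finrank ℚ k₀ = 2) {Φ : CMType K} {σ₀ : K →+* ℂ} (hσ₀ : σ₀ ∈ Φ.1)
    (hsp : ∀ φ ∈ Φ.1, φ.comp (algebraMap k₀ K) = σ₀.comp (algebraMap k₀ K) → φ = σ₀) {τ : ℂ ≃+* ℂ}
    (hτ : τ • σ₀ = σ₀) : cmTypeSmul τ Φ = Φ := by
  rw [cmTypeSmul_eq_self_iff, ← forall_smul_mem_iff_iff_forall_apply_traceField_eq]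
  exact smul_mem_iff_of_smul_special_eq k₀ hk₀ hσ₀ hsp hτ

/-- **`K* ⊆ σ₀(K)`: the reflex field `ℚ(tr_Φ(K)) ⊂ ℂ` of a CM type with special element `σ₀` lies in the conjugate
`σ₀(K)` of `K`** («It follows that `φ^sp(K) ⊂ K_Φ`» for any `K_Φ ⊇ K₀` containing the reflex field, «and that we
may take `K_Φ = φ^sp(K)`»): `Aut(ℂ/σ₀(K)) ≤ Stab(Φ) = Aut(ℂ/K*)` and the Galois correspondence for `Aut(ℂ)` (tree
`exists_ringEquiv_apply_ne_of_not_mem`). [cite: Howard2012, §3.1] [cite: Shimura1998, §8.3 Prop. 28] -/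
theorem traceField_le_fieldRange_of_special (hk₀ : finrank ℚ k₀ = 2) {Φ : CMType K} {σ₀ : K →+* ℂ}
    (hσ₀ : σ₀ ∈ Φ.1) (hsp : ∀ φ ∈ Φ.1, φ.comp (algebraMap k₀ K) = σ₀.comp (algebraMap k₀ K) → φ = σ₀) :
    traceField Φ ≤ σ₀.toRatAlgHom.fieldRange := by
  haveI : FiniteDimensional ℚ σ₀.toRatAlgHom.fieldRange := finiteDimensional_fieldRange_sp σ₀
  haveI : FiniteDimensional ℚ (traceField Φ) := finiteDimensional_traceField_sp Φ
  intro z hz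
  by_contra hzM
  obtain ⟨τ, hτM, hτz⟩ := exists_ringEquiv_apply_ne_of_not_mem (M := σ₀.toRatAlgHom.fieldRange)
    (N := traceField Φ) hz hzM
  have hτσ : τ • σ₀ = σ₀ := RingHom.ext fun x => by
    rw [ringEquiv_smul_apply]
    exact hτM _ (AlgHom.mem_fieldRange.2 ⟨x, rfl⟩)
  exact hτz ((forall_smul_mem_iff_iff_forall_apply_traceField_eq τ Φ).1
    (smul_mem_iff_of_smul_special_eq k₀ hk₀ hσ₀ hsp hτσ) z hz)

/-- Hence `[K* : ℚ] ≤ [K : ℚ]` for a type with a special element. [cite: Howard2012, §3.1] -/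
theorem finrank_traceField_le_finrank_of_special (hk₀ : finrank ℚ k₀ = 2) {Φ : CMType K} {σ₀ : K →+* ℂ}
    (hσ₀ : σ₀ ∈ Φ.1) (hsp : ∀ φ ∈ Φ.1, φ.comp (algebraMap k₀ K) = σ₀.comp (algebraMap k₀ K) → φ = σ₀) :
    finrank ℚ (traceField Φ) ≤ finrank ℚ K := by
  haveI : FiniteDimensional ℚ σ₀.toRatAlgHom.fieldRange := finiteDimensional_fieldRange_sp σ₀
  rw [← finrank_fieldRange_sp σ₀]
  exact IntermediateField.finrank_le_of_le_right (traceField_le_fieldRange_of_special k₀ hk₀ hσ₀ hsp)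

/-! ## §3 `[K : ℚ] ≥ 6`: `Stab(Φ) = Aut(ℂ/σ₀(K))`, `K* = σ₀(K) ≅ K`, uniqueness of the special element, primitivity,
## and the Galois class of the special types -/

omit [IsCMField K] in
/-- **Conversely (for `[K : ℚ] ≥ 6`): an automorphism of `ℂ` fixing the type fixes its special element** — `τΦ = Φ`
forces `τ` to fix `σ₀|_{k₀}` (otherwise `τ` would carry the `≥ 2` members of `Φ` above `\overline{σ₀|_{k₀}}` onto the
single member above `σ₀|_{k₀}`) and then `τσ₀ = σ₀` by uniqueness (Howard's «only if», here without assuming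
`τ ∈ Aut(ℂ/K₀)`). [cite: Howard2012, §3.1] -/
theorem smul_special_eq_of_forall_smul_mem_iff (hk₀ : finrank ℚ k₀ = 2) (h6 : 6 ≤ finrank ℚ K) {Φ : CMType K}
    {σ₀ : K →+* ℂ} (hσ₀ : σ₀ ∈ Φ.1)
    (hsp : ∀ φ ∈ Φ.1, φ.comp (algebraMap k₀ K) = σ₀.comp (algebraMap k₀ K) → φ = σ₀) {τ : ℂ ≃+* ℂ}
    (hτ : ∀ χ : K →+* ℂ, τ • χ ∈ Φ.1 ↔ χ ∈ Φ.1) : τ • σ₀ = σ₀ := by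
  by_contra hne
  have hτσ : τ • σ₀ ∈ Φ.1 := (hτ σ₀).2 hσ₀
  have hres : (τ • σ₀).comp (algebraMap k₀ K) = ComplexEmbedding.conjugate (σ₀.comp (algebraMap k₀ K)) :=
    comp_eq_conjugate_of_mem_of_ne_special k₀ hk₀ hsp hτσ hne
  obtain ⟨χ₁, χ₂, h₁, h₂, h12, h₁e, h₂e⟩ := exists_two_fibre_sp k₀ hk₀ h6
    (ComplexEmbedding.conjugate (σ₀.comp (algebraMap k₀ K))) (ComplexEmbedding.conjugate σ₀)
  have hχ₁ : χ₁ ∈ Φ.1 := mem_of_comp_eq_conjugate_of_ne_special k₀ hk₀ hσ₀ hsp h₁ h₁e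
  have hχ₂ : χ₂ ∈ Φ.1 := mem_of_comp_eq_conjugate_of_ne_special k₀ hk₀ hσ₀ hsp h₂ h₂e
  -- a member `χ` of `Φ` above `ῑ` with `τχ ≠ σ₀` is impossible: `τχ ∈ Φ ∖ {σ₀}` lies above `ῑ = τῑ`, whereas
  -- `τσ₀ ≠ σ₀` lies above `ῑ = τι`, so `τι = τῑ`
  have key : ∀ χ : K →+* ℂ, χ ∈ Φ.1 →
      χ.comp (algebraMap k₀ K) = ComplexEmbedding.conjugate (σ₀.comp (algebraMap k₀ K)) → τ • χ ≠ σ₀ → False := by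
    intro χ hχ hχres hτχ
    have hτχ' : τ • χ ∈ Φ.1 := (hτ χ).2 hχ
    have h := comp_eq_conjugate_of_mem_of_ne_special k₀ hk₀ hsp hτχ' hτχ
    rw [smul_comp_sp, hχres] at h
    rw [smul_comp_sp] at hres
    exact conjugate_ne_sp k₀ (σ₀.comp (algebraMap k₀ K)) (MulAction.injective τ (h.trans hres.symm))
  by_cases hτ₁ : τ • χ₁ = σ₀
  · exact key χ₂ hχ₂ h₂ fun hτ₂ => h12 (MulAction.injective τ (hτ₁.trans hτ₂.symm))
  · exact key χ₁ hχ₁ h₁ hτ₁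

/-- **`Stab(Φ) = Stab(σ₀) = Aut(ℂ/σ₀(K))`** for `[K : ℚ] ≥ 6`: `τΦ = Φ ⟺ τσ₀ = σ₀`. [cite: Howard2012, §3.1] -/
theorem forall_smul_mem_iff_iff_smul_special_eq (hk₀ : finrank ℚ k₀ = 2) (h6 : 6 ≤ finrank ℚ K) {Φ : CMType K}
    {σ₀ : K →+* ℂ} (hσ₀ : σ₀ ∈ Φ.1)
    (hsp : ∀ φ ∈ Φ.1, φ.comp (algebraMap k₀ K) = σ₀.comp (algebraMap k₀ K) → φ = σ₀) (τ : ℂ ≃+* ℂ) :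
    (∀ χ : K →+* ℂ, τ • χ ∈ Φ.1 ↔ χ ∈ Φ.1) ↔ τ • σ₀ = σ₀ :=
  ⟨fun h => smul_special_eq_of_forall_smul_mem_iff k₀ hk₀ h6 hσ₀ hsp h,
    fun h => smul_mem_iff_of_smul_special_eq k₀ hk₀ hσ₀ hsp h⟩

/-- `τΦ = Φ ⟺ τσ₀ = σ₀` in `cmTypeSmul` form. [cite: Howard2012, §3.1] -/
theorem cmTypeSmul_eq_self_iff_smul_special_eq (hk₀ : finrank ℚ k₀ = 2) (h6 : 6 ≤ finrank ℚ K) {Φ : CMType K}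
    {σ₀ : K →+* ℂ} (hσ₀ : σ₀ ∈ Φ.1)
    (hsp : ∀ φ ∈ Φ.1, φ.comp (algebraMap k₀ K) = σ₀.comp (algebraMap k₀ K) → φ = σ₀) (τ : ℂ ≃+* ℂ) :
    cmTypeSmul τ Φ = Φ ↔ τ • σ₀ = σ₀ := by
  rw [cmTypeSmul_eq_self_iff, ← forall_smul_mem_iff_iff_forall_apply_traceField_eq]
  exact forall_smul_mem_iff_iff_smul_special_eq k₀ hk₀ h6 hσ₀ hsp τ

/-- **THE REFLEX FIELD OF A CM TYPE WITH A SPECIAL ELEMENT IS `σ₀(K)`** (`[K : ℚ] ≥ 6`): `K* = ℚ(tr_Φ(K)) = σ₀(K)`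
as subfields of `ℂ` («we may take `K_Φ = φ^sp(K)`»; for sextic `D₆` fields DIS Prop. 18 «`K₂^r = σ(K)`»).
[cite: Howard2012, §3.1] [cite: DinaIonicaSijsling2022, §1.3 Prop. 18] [cite: Shimura1998, §8.3 Prop. 28] -/
theorem traceField_eq_fieldRange_of_special (hk₀ : finrank ℚ k₀ = 2) (h6 : 6 ≤ finrank ℚ K) {Φ : CMType K}
    {σ₀ : K →+* ℂ} (hσ₀ : σ₀ ∈ Φ.1)
    (hsp : ∀ φ ∈ Φ.1, φ.comp (algebraMap k₀ K) = σ₀.comp (algebraMap k₀ K) → φ = σ₀) :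
    traceField Φ = σ₀.toRatAlgHom.fieldRange := by
  refine le_antisymm (traceField_le_fieldRange_of_special k₀ hk₀ hσ₀ hsp) fun z hz => ?_
  haveI : FiniteDimensional ℚ σ₀.toRatAlgHom.fieldRange := finiteDimensional_fieldRange_sp σ₀
  haveI : FiniteDimensional ℚ (traceField Φ) := finiteDimensional_traceField_sp Φ
  by_contra hzN
  obtain ⟨τ, hτN, hτz⟩ := exists_ringEquiv_apply_ne_of_not_mem (M := traceField Φ)
    (N := σ₀.toRatAlgHom.fieldRange) hz hzN
  have hstab : ∀ χ : K →+* ℂ, τ • χ ∈ Φ.1 ↔ χ ∈ Φ.1 :=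
    (forall_smul_mem_iff_iff_forall_apply_traceField_eq τ Φ).2 hτN
  have hτσ := smul_special_eq_of_forall_smul_mem_iff k₀ hk₀ h6 hσ₀ hsp hstab
  obtain ⟨x, rfl⟩ := AlgHom.mem_fieldRange.1 hz
  apply hτz
  change τ (σ₀ x) = σ₀ x
  rw [← ringEquiv_smul_apply τ σ₀ x, hτσ]

/-- **`[K* : ℚ] = [K : ℚ]`** for a type with a special element (`[K : ℚ] ≥ 6`). [cite: Howard2012, §3.1]
[cite: DinaIonicaSijsling2022, §1.3 Prop. 18] -/
theorem finrank_traceField_eq_finrank_of_special (hk₀ : finrank ℚ k₀ = 2) (h6 : 6 ≤ finrank ℚ K) {Φ : CMType K}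
    {σ₀ : K →+* ℂ} (hσ₀ : σ₀ ∈ Φ.1)
    (hsp : ∀ φ ∈ Φ.1, φ.comp (algebraMap k₀ K) = σ₀.comp (algebraMap k₀ K) → φ = σ₀) :
    finrank ℚ (traceField Φ) = finrank ℚ K := by
  rw [traceField_eq_fieldRange_of_special k₀ hk₀ h6 hσ₀ hsp, finrank_fieldRange_sp]

/-- **`K* ≅ K`**: the reflex field of a CM type with a special element is isomorphic to `K` (`[K : ℚ] ≥ 6`) — DIS
Props. 16/18 «`(K^r, Φ^r) = (K, Φ)`», «`K₂^r = σ(K)`» for sextic fields. [cite: Howard2012, §3.1]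
[cite: DinaIonicaSijsling2022, §1.3 Props. 16 and 18] -/
theorem nonempty_ringEquiv_traceField_of_special (hk₀ : finrank ℚ k₀ = 2) (h6 : 6 ≤ finrank ℚ K) {Φ : CMType K}
    {σ₀ : K →+* ℂ} (hσ₀ : σ₀ ∈ Φ.1)
    (hsp : ∀ φ ∈ Φ.1, φ.comp (algebraMap k₀ K) = σ₀.comp (algebraMap k₀ K) → φ = σ₀) :
    Nonempty (K ≃+* traceField Φ) :=
  nonempty_ringEquiv_of_eq_fieldRange_sp σ₀ (traceField_eq_fieldRange_of_special k₀ hk₀ h6 hσ₀ hsp)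

omit [IsCMField K] in
/-- **The special element is unique** (`[K : ℚ] ≥ 6`; «there is a unique `φ^sp ∈ Φ`»: a second one would have to be
alone above `\overline{σ₀|_{k₀}}`, where `Φ` has `n − 1 ≥ 2` members). [cite: Howard2012, §3.1] -/
theorem special_unique (hk₀ : finrank ℚ k₀ = 2) (h6 : 6 ≤ finrank ℚ K) {Φ : CMType K} {σ₀ σ₁ : K →+* ℂ}
    (hσ₀ : σ₀ ∈ Φ.1) (hsp₀ : ∀ φ ∈ Φ.1, φ.comp (algebraMap k₀ K) = σ₀.comp (algebraMap k₀ K) → φ = σ₀)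
    (hσ₁ : σ₁ ∈ Φ.1) (hsp₁ : ∀ φ ∈ Φ.1, φ.comp (algebraMap k₀ K) = σ₁.comp (algebraMap k₀ K) → φ = σ₁) :
    σ₁ = σ₀ := by
  by_contra hne
  have hres := comp_eq_conjugate_of_mem_of_ne_special k₀ hk₀ hsp₀ hσ₁ hne
  obtain ⟨χ₁, χ₂, h₁, h₂, h12, h₁e, h₂e⟩ := exists_two_fibre_sp k₀ hk₀ h6
    (ComplexEmbedding.conjugate (σ₀.comp (algebraMap k₀ K))) (ComplexEmbedding.conjugate σ₀)
  have hχ₁ : χ₁ ∈ Φ.1 := mem_of_comp_eq_conjugate_of_ne_special k₀ hk₀ hσ₀ hsp₀ h₁ h₁e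
  have hχ₂ : χ₂ ∈ Φ.1 := mem_of_comp_eq_conjugate_of_ne_special k₀ hk₀ hσ₀ hsp₀ h₂ h₂e
  exact h12 ((hsp₁ χ₁ hχ₁ (h₁.trans hres.symm)).trans (hsp₁ χ₂ hχ₂ (h₂.trans hres.symm)).symm)

omit [IsTotallyComplex k₀] in
/-- **The Galois class of a type with special element `σ₀` consists of the types with a special element** (`τΦ` has
special element `τσ₀`, and `Aut(ℂ)` is transitive on `Hom(K, ℂ)`): `Φ ~ Ψ ⟺ Ψ` has a special element (any degree).
[cite: Howard2012, §3.1] [cite: DinaIonicaSijsling2022, §1.3 Prop. 17] -/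
theorem galoisRel_iff_exists_special [IsTotallyComplex k₀] (hk₀ : finrank ℚ k₀ = 2) {Φ : CMType K} {σ₀ : K →+* ℂ}
    (hσ₀ : σ₀ ∈ Φ.1) (hsp : ∀ φ ∈ Φ.1, φ.comp (algebraMap k₀ K) = σ₀.comp (algebraMap k₀ K) → φ = σ₀)
    (Ψ : CMType K) :
    (cmTypeGaloisSetoid K).r Φ Ψ ↔
      ∃ σ₁ : K →+* ℂ, σ₁ ∈ Ψ.1 ∧ ∀ φ ∈ Ψ.1, φ.comp (algebraMap k₀ K) = σ₁.comp (algebraMap k₀ K) → φ = σ₁ := by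
  constructor
  · rintro ⟨τ, rfl⟩
    exact ⟨τ • σ₀, special_cmTypeSmul k₀ hσ₀ hsp τ⟩
  · rintro ⟨σ₁, hσ₁, hsp₁⟩
    haveI := isPretransitive_ringEquiv_complex (K := K)
    obtain ⟨τ, hτ⟩ := MulAction.exists_smul_eq (ℂ ≃+* ℂ) σ₀ σ₁
    obtain ⟨h1, h2⟩ := special_cmTypeSmul k₀ hσ₀ hsp τ
    rw [hτ] at h1 h2
    exact ⟨τ, (eq_of_special k₀ hk₀ h1 h2 hσ₁ hsp₁).symm⟩

/-- **The Galois class of a type with a special element has exactly `[K : ℚ]` members** (`[K : ℚ] ≥ 6`; its size is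
`[K* : ℚ]`, tree `natCard_galoisClass_eq_finrank_traceField`). [cite: Howard2012, §3.1] [cite: Shimura1998, §8.3 Prop. 28] -/
theorem natCard_galoisClass_eq_finrank_of_special (hk₀ : finrank ℚ k₀ = 2) (h6 : 6 ≤ finrank ℚ K) {Φ : CMType K}
    {σ₀ : K →+* ℂ} (hσ₀ : σ₀ ∈ Φ.1)
    (hsp : ∀ φ ∈ Φ.1, φ.comp (algebraMap k₀ K) = σ₀.comp (algebraMap k₀ K) → φ = σ₀) :
    Nat.card {Ψ : CMType K // ∃ τ : ℂ ≃+* ℂ, Ψ = cmTypeSmul τ Φ} = finrank ℚ K := by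
  rw [natCard_galoisClass_eq_finrank_traceField, finrank_traceField_eq_finrank_of_special k₀ hk₀ h6 hσ₀ hsp]

/-- **There are exactly `[K : ℚ]` CM types with a special element** (`[K : ℚ] ≥ 6`), one for each embedding `σ₀`, and
they form a single Galois class. [cite: Howard2012, §3.1] -/
theorem natCard_special_eq_finrank (hk₀ : finrank ℚ k₀ = 2) (h6 : 6 ≤ finrank ℚ K) :
    Nat.card {Ψ : CMType K // ∃ σ₁ : K →+* ℂ, σ₁ ∈ Ψ.1 ∧
      ∀ φ ∈ Ψ.1, φ.comp (algebraMap k₀ K) = σ₁.comp (algebraMap k₀ K) → φ = σ₁} = finrank ℚ K := by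
  obtain ⟨σ₀⟩ := (inferInstance : Nonempty (K →+* ℂ))
  obtain ⟨Φ, hσ₀, hsp⟩ := exists_special k₀ hk₀ σ₀
  rw [← natCard_galoisClass_eq_finrank_of_special k₀ hk₀ h6 hσ₀ hsp]
  exact Nat.card_congr (Equiv.subtypeEquivRight fun Ψ => (galoisRel_iff_exists_special k₀ hk₀ hσ₀ hsp Ψ).symm)

/-- **A CM type with a special element is PRIMITIVE** (`[K : ℚ] ≥ 6`): by the separation criterion
(`isPrimitive_iff_forall_eq`) two embeddings `x ≠ y` lying in the same Galois conjugates of `Φ` would lie in the same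
special types `Φ_s`; `s = x` forces `y|_{k₀} = x̄|_{k₀}`, and then a special type `Φ_s` with `s ≠ x̄, y` above `x̄|_{k₀}`
contains `x` but not `y`.  (In the sextic case: DIS Props. 16, 18 — the types `{id, σ, σ⁻¹}|_K, …` are the primitive
ones.) [cite: Howard2012, §3.1] [cite: DinaIonicaSijsling2022, §1.3 Props. 16 and 18] [cite: Shimura1998, §8.2 Prop. 26] -/
theorem isPrimitive_of_special (hk₀ : finrank ℚ k₀ = 2) (h6 : 6 ≤ finrank ℚ K) {Φ : CMType K} {σ₀ : K →+* ℂ}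
    (hσ₀ : σ₀ ∈ Φ.1) (hsp : ∀ φ ∈ Φ.1, φ.comp (algebraMap k₀ K) = σ₀.comp (algebraMap k₀ K) → φ = σ₀)
    (φ₀ : K →+* ℂ) : IsPrimitive (ℂ ≃+* ℂ) Φ.1 φ₀ := by
  haveI := isPretransitive_ringEquiv_complex (K := K)
  rw [isPrimitive_iff_forall_eq]
  intro x y hxy
  -- `x` and `y` lie in the same special types
  have hΦs : ∀ s : K →+* ℂ, ∃ Ψ : CMType K, (s ∈ Ψ.1 ∧
      ∀ φ ∈ Ψ.1, φ.comp (algebraMap k₀ K) = s.comp (algebraMap k₀ K) → φ = s) ∧ (x ∈ Ψ.1 ↔ y ∈ Ψ.1) := fun s => by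
    obtain ⟨b, hb⟩ := MulAction.exists_smul_eq (ℂ ≃+* ℂ) σ₀ s
    refine ⟨cmTypeSmul b Φ, ?_, ?_⟩
    · have h := special_cmTypeSmul k₀ hσ₀ hsp b
      rwa [hb] at h
    · rw [cmTypeSmul_val, Set.mem_smul_set_iff_inv_smul_mem, Set.mem_smul_set_iff_inv_smul_mem]
      exact hxy b⁻¹
  by_contra hne
  obtain ⟨Ψ, ⟨hx, hspx⟩, hiff⟩ := hΦs x
  rcases (mem_iff_of_special k₀ hk₀ hx hspx y).1 (hiff.1 hx) with h | ⟨hyres, hybar⟩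
  · exact hne h.symm
  have hyres' : y.comp (algebraMap k₀ K) = ComplexEmbedding.conjugate (x.comp (algebraMap k₀ K)) := by
    rcases eq_or_eq_conjugate_sp k₀ hk₀ (x.comp (algebraMap k₀ K)) (y.comp (algebraMap k₀ K)) with h | h
    · exact absurd h hyres
    · exact h
  obtain ⟨χ₁, χ₂, h₁, h₂, h12, h₁e, h₂e⟩ := exists_two_fibre_sp k₀ hk₀ h6
    (ComplexEmbedding.conjugate (x.comp (algebraMap k₀ K))) (ComplexEmbedding.conjugate x)
  have main : ∀ s : K →+* ℂ, s.comp (algebraMap k₀ K) = ComplexEmbedding.conjugate (x.comp (algebraMap k₀ K)) →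
      s ≠ ComplexEmbedding.conjugate x → s ≠ y → False := by
    intro s hs hsx hsy
    obtain ⟨Θ, ⟨hsΘ, hspΘ⟩, hiffΘ⟩ := hΦs s
    have hxΘ : x ∈ Θ.1 := by
      refine (mem_iff_of_special k₀ hk₀ hsΘ hspΘ x).2 (Or.inr ⟨?_, fun h => hsx ?_⟩)
      · rw [hs]
        exact (conjugate_ne_sp k₀ _).symm
      · rw [h]
        exact (ComplexEmbedding.involutive_conjugate K s).symm
    rcases (mem_iff_of_special k₀ hk₀ hsΘ hspΘ y).1 (hiffΘ.1 hxΘ) with h | ⟨hyres'', _⟩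
    · exact hsy h.symm
    · exact hyres'' (hyres'.trans hs.symm)
  by_cases hy₁ : χ₁ = y
  · exact main χ₂ h₂ h₂e fun h => h12 (hy₁.trans h.symm)
  · exact main χ₁ h₁ h₁e hy₁

/-- A type with a special element is not induced from any CM type of a strict subfield (Streng's form of
primitivity, tree `SiegelCMPoint.not_exists_inducedCMType_iff_isPrimitive`). [cite: Howard2012, §3.1]
[cite: Streng2010, Ch. I Def. 3.2] -/
theorem not_exists_inducedCMType_of_special (hk₀ : finrank ℚ k₀ = 2) (h6 : 6 ≤ finrank ℚ K) {Φ : CMType K}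
    {σ₀ : K →+* ℂ} (hσ₀ : σ₀ ∈ Φ.1)
    (hsp : ∀ φ ∈ Φ.1, φ.comp (algebraMap k₀ K) = σ₀.comp (algebraMap k₀ K) → φ = σ₀) :
    ¬ ∃ (k : IntermediateField ℚ K) (Ψ : CMType k), k ≠ ⊤ ∧ inducedCMType (algebraMap k K) Ψ = Φ :=
  (SiegelCMPoint.not_exists_inducedCMType_iff_isPrimitive Φ σ₀).2 (isPrimitive_of_special k₀ hk₀ h6 hσ₀ hsp σ₀)

end Special

/-! ## §4 Sextic CM fields containing an imaginary quadratic field: primitive ⟺ special; DIS Props. 16 & 18 -/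

section Sextic

variable [IsCMField K] (k₀ : IntermediateField ℚ K) [IsTotallyComplex k₀]

omit [IsCMField K] [IsTotallyComplex k₀] in
/-- Above every embedding of `k₀` lie exactly three embeddings of the sextic `K`. [cite: DinaIonicaSijsling2022, §1.3 Def. 15] -/
private theorem fibre_eq_three_sp (hk₀ : finrank ℚ k₀ = 2) (h6 : finrank ℚ K = 6) (ψ : k₀ →+* ℂ) :
    ∃ a b c : K →+* ℂ, a ≠ b ∧ a ≠ c ∧ b ≠ c ∧
      ∀ φ : K →+* ℂ, φ.comp (algebraMap k₀ K) = ψ ↔ (φ = a ∨ φ = b ∨ φ = c) := by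
  classical
  have hcard : (Finset.univ.filter fun φ : K →+* ℂ => φ.comp (algebraMap k₀ K) = ψ).card = 3 := by
    rw [card_fibre_eq_finrank (K := K) (k := k₀) ψ]
    have htower := Module.finrank_mul_finrank ℚ k₀ K
    rw [hk₀, h6] at htower
    omega
  obtain ⟨a, b, c, hab, hac, hbc, hF⟩ := Finset.card_eq_three.1 hcard
  refine ⟨a, b, c, hab, hac, hbc, fun φ => ?_⟩
  have h : φ ∈ (Finset.univ.filter fun φ : K →+* ℂ => φ.comp (algebraMap k₀ K) = ψ) ↔
      φ ∈ ({a, b, c} : Finset (K →+* ℂ)) := by rw [hF]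
  simpa only [Finset.mem_filter, Finset.mem_univ, true_and, Finset.mem_insert, Finset.mem_singleton] using h

omit [IsCMField K] in
/-- If `Φ` contains the whole fibre above an embedding `ψ` of `k₀`, then `Φ` is induced from the CM type `{ψ}` of
`k₀`. [cite: DinaIonicaSijsling2022, §1.3 Prop. 16 («the reflex CM type of an imprimitive CM type … is the restriction
… to the quadratic CM subfield»)] [cite: Streng2010, Ch. I Def. 3.2] -/
theorem exists_inducedCMType_eq_of_fibre_subset (hk₀ : finrank ℚ k₀ = 2) {Φ : CMType K} {ψ : k₀ →+* ℂ}
    (hall : ∀ φ : K →+* ℂ, φ.comp (algebraMap k₀ K) = ψ → φ ∈ Φ.1) :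
    ∃ Ψ₀ : CMType k₀, inducedCMType (algebraMap k₀ K) Ψ₀ = Φ := by
  refine ⟨⟨{ψ}, fun χ => ?_⟩, Subtype.ext <| Set.ext fun φ => ?_⟩
  · rw [Set.mem_singleton_iff, Set.mem_singleton_iff]
    constructor
    · rintro rfl
      exact conjugate_ne_sp k₀ χ
    · intro h
      rcases eq_or_eq_conjugate_sp k₀ hk₀ ψ χ with h' | h'
      · exact h'
      · exfalso
        apply h
        rw [h']
        exact ComplexEmbedding.involutive_conjugate _ ψ
  · rw [mem_inducedCMType_iff]
    change φ.comp (algebraMap k₀ K) ∈ ({ψ} : Set (k₀ →+* ℂ)) ↔ φ ∈ Φ.1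
    rw [Set.mem_singleton_iff]
    refine ⟨hall φ, fun hφ => ?_⟩
    by_contra hne
    rcases eq_or_eq_conjugate_sp k₀ hk₀ ψ (φ.comp (algebraMap k₀ K)) with h | h
    · exact hne h
    have hbar : ComplexEmbedding.conjugate φ ∈ Φ.1 :=
      hall _ (by rw [conjugate_comp_sp, h]; exact ComplexEmbedding.involutive_conjugate _ ψ)
    exact (Φ.2 φ).1 hφ hbar

omit [IsCMField K] in
/-- **SEXTIC `K ⊇ k₀`: a PRIMITIVE CM type has a special element** — `Φ` meets the two fibres of `Hom(K, ℂ) → Hom(k₀, ℂ)`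
in `(2, 1)` or `(1, 2)` embeddings (`(3, 0)`, `(0, 3)` are the two types induced from `k₀`), and the lone one is special
(DIS: the primitive types of `C₆`/`D₆` fields are `{id, σ, σ⁻¹}|_K` and its conjugates, the imprimitive one is
`{id, σ², σ⁻²}|_K`). [cite: DinaIonicaSijsling2022, §1.3 Def. 15, Props. 16 and 18] [cite: Howard2012, §3.1] -/
theorem exists_special_of_isPrimitive_sextic (hk₀ : finrank ℚ k₀ = 2) (h6 : finrank ℚ K = 6) {Φ : CMType K}
    {φ₀ : K →+* ℂ} (hprim : IsPrimitive (ℂ ≃+* ℂ) Φ.1 φ₀) :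
    ∃ σ₀ : K →+* ℂ, σ₀ ∈ Φ.1 ∧ ∀ φ ∈ Φ.1, φ.comp (algebraMap k₀ K) = σ₀.comp (algebraMap k₀ K) → φ = σ₀ := by
  have hnot : ¬ ∃ Ψ₀ : CMType k₀, inducedCMType (algebraMap k₀ K) Ψ₀ = Φ :=
    (isPrimitive_iff_not_exists_inducedCMType_quadratic k₀ h6 hk₀ Φ φ₀).1 hprim
  have hind : ∀ ψ : k₀ →+* ℂ, (∀ φ : K →+* ℂ, φ.comp (algebraMap k₀ K) = ψ → φ ∈ Φ.1) → False :=
    fun ψ hall => hnot (exists_inducedCMType_eq_of_fibre_subset k₀ hk₀ hall)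
  -- one member of the fibre above `ψ` in `Φ`: it is special
  have one_in : ∀ (ψ : k₀ →+* ℂ) (s : K →+* ℂ), s.comp (algebraMap k₀ K) = ψ → s ∈ Φ.1 →
      (∀ φ : K →+* ℂ, φ.comp (algebraMap k₀ K) = ψ → φ ∈ Φ.1 → φ = s) →
      ∃ σ₀ : K →+* ℂ, σ₀ ∈ Φ.1 ∧ ∀ φ ∈ Φ.1, φ.comp (algebraMap k₀ K) = σ₀.comp (algebraMap k₀ K) → φ = σ₀ :=
    fun ψ s hs hsΦ huniq => ⟨s, hsΦ, fun φ hφ hres => huniq φ (hres.trans hs) hφ⟩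
  -- one member `e` of the fibre above `ψ` outside `Φ`: `ē` is special
  have one_out : ∀ (ψ : k₀ →+* ℂ) (e : K →+* ℂ), e.comp (algebraMap k₀ K) = ψ → e ∉ Φ.1 →
      (∀ φ : K →+* ℂ, φ.comp (algebraMap k₀ K) = ψ → φ ≠ e → φ ∈ Φ.1) →
      ∃ σ₀ : K →+* ℂ, σ₀ ∈ Φ.1 ∧ ∀ φ ∈ Φ.1, φ.comp (algebraMap k₀ K) = σ₀.comp (algebraMap k₀ K) → φ = σ₀ := by
    intro ψ e he heΦ hrest
    refine ⟨ComplexEmbedding.conjugate e, ?_, fun φ hφ hres => ?_⟩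
    · by_contra h
      exact heΦ ((Φ.2 e).2 h)
    · have hres' : (ComplexEmbedding.conjugate φ).comp (algebraMap k₀ K) = ψ := by
        rw [conjugate_comp_sp, hres, conjugate_comp_sp, he]
        exact ComplexEmbedding.involutive_conjugate _ ψ
      have hnotin : ComplexEmbedding.conjugate φ ∉ Φ.1 := (Φ.2 φ).1 hφ
      by_contra hne
      refine hnotin (hrest _ hres' fun h => hne ?_)
      rw [← h]
      exact (ComplexEmbedding.involutive_conjugate K φ).symm
  obtain ⟨a, b, c, hab, hac, hbc, hfib⟩ := fibre_eq_three_sp k₀ hk₀ h6 (φ₀.comp (algebraMap k₀ K))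
  have ha' := (hfib a).2 (Or.inl rfl)
  have hb' := (hfib b).2 (Or.inr (Or.inl rfl))
  have hc' := (hfib c).2 (Or.inr (Or.inr rfl))
  by_cases ha : a ∈ Φ.1 <;> by_cases hb : b ∈ Φ.1 <;> by_cases hc : c ∈ Φ.1
  · exact (hind _ fun φ hφ => by
      rcases (hfib φ).1 hφ with rfl | rfl | rfl <;> assumption).elim
  · exact one_out _ c hc' hc fun φ hφ hne => by
      rcases (hfib φ).1 hφ with rfl | rfl | rfl
      · exact ha
      · exact hb
      · exact absurd rfl hne
  · exact one_out _ b hb' hb fun φ hφ hne => by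
      rcases (hfib φ).1 hφ with rfl | rfl | rfl
      · exact ha
      · exact absurd rfl hne
      · exact hc
  · exact one_in _ a ha' ha fun φ hφ hφΦ => by
      rcases (hfib φ).1 hφ with rfl | rfl | rfl
      · rfl
      · exact absurd hφΦ hb
      · exact absurd hφΦ hc
  · exact one_out _ a ha' ha fun φ hφ hne => by
      rcases (hfib φ).1 hφ with rfl | rfl | rfl
      · exact absurd rfl hne
      · exact hb
      · exact hc
  · exact one_in _ b hb' hb fun φ hφ hφΦ => by
      rcases (hfib φ).1 hφ with rfl | rfl | rfl
      · exact absurd hφΦ ha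
      · rfl
      · exact absurd hφΦ hc
  · exact one_in _ c hc' hc fun φ hφ hφΦ => by
      rcases (hfib φ).1 hφ with rfl | rfl | rfl
      · exact absurd hφΦ ha
      · exact absurd hφΦ hb
      · rfl
  · -- no member of the fibre above `ψ` lies in `Φ`: the whole fibre above `ψ̄` does
    refine (hind (ComplexEmbedding.conjugate (φ₀.comp (algebraMap k₀ K))) fun φ hφ => ?_).elim
    have hbar : (ComplexEmbedding.conjugate φ).comp (algebraMap k₀ K) = φ₀.comp (algebraMap k₀ K) := by
      rw [conjugate_comp_sp, hφ]
      exact ComplexEmbedding.involutive_conjugate _ _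
    by_contra hφΦ
    have hbarΦ : ComplexEmbedding.conjugate φ ∈ Φ.1 := by
      by_contra h'
      exact hφΦ ((Φ.2 φ).2 h')
    rcases (hfib _).1 hbar with h | h | h
    · exact ha (h ▸ hbarΦ)
    · exact hb (h ▸ hbarΦ)
    · exact hc (h ▸ hbarΦ)

/-- **SEXTIC `K ⊇ k₀`: primitive ⟺ has a special element.** [cite: DinaIonicaSijsling2022, §1.3 Def. 15, Props. 16 and 18]
[cite: Howard2012, §3.1] -/
theorem isPrimitive_iff_exists_special_sextic (hk₀ : finrank ℚ k₀ = 2) (h6 : finrank ℚ K = 6) (Φ : CMType K)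
    (φ₀ : K →+* ℂ) :
    IsPrimitive (ℂ ≃+* ℂ) Φ.1 φ₀ ↔
      ∃ σ₀ : K →+* ℂ, σ₀ ∈ Φ.1 ∧ ∀ φ ∈ Φ.1, φ.comp (algebraMap k₀ K) = σ₀.comp (algebraMap k₀ K) → φ = σ₀ :=
  ⟨fun h => exists_special_of_isPrimitive_sextic k₀ hk₀ h6 h,
    fun ⟨_, hσ₀, hsp⟩ => isPrimitive_of_special k₀ hk₀ (by omega) hσ₀ hsp φ₀⟩

/-- **DIS PROPS. 16 & 18 (`C₆` and `D₆` uniformly): the reflex field of a PRIMITIVE CM type of a sextic CM field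
containing an imaginary quadratic field is `σ₀(K) ⊂ ℂ` for a member `σ₀ ∈ Φ`** (its special element) — «`(K^r, Φ^r) =
(K, Φ)`» (`C₆`), «`(K₂^r, Φ₂^r) = (σ(K), Φσ⁻¹)`» (`D₆`). [cite: DinaIonicaSijsling2022, §1.3 Props. 16 and 18]
[cite: Howard2012, §3.1] -/
theorem exists_traceField_eq_fieldRange_of_isPrimitive_sextic (hk₀ : finrank ℚ k₀ = 2) (h6 : finrank ℚ K = 6)
    {Φ : CMType K} {φ₀ : K →+* ℂ} (hprim : IsPrimitive (ℂ ≃+* ℂ) Φ.1 φ₀) :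
    ∃ σ₀ : K →+* ℂ, σ₀ ∈ Φ.1 ∧ traceField Φ = σ₀.toRatAlgHom.fieldRange := by
  obtain ⟨σ₀, hσ₀, hsp⟩ := exists_special_of_isPrimitive_sextic k₀ hk₀ h6 hprim
  exact ⟨σ₀, hσ₀, traceField_eq_fieldRange_of_special k₀ hk₀ (by omega) hσ₀ hsp⟩

/-- The same relative to ANY embedding `φ : K → ℂ`: **`K* = τ(φ(K))` is a conjugate of `φ(K)` by some `τ ∈ Aut(ℂ)`**
(DIS Prop. 18: the reflex fields of the three primitive classes up to equivalence are `K`, `σ(K)`, `σ⁻¹(K)` inside the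
Galois closure). [cite: DinaIonicaSijsling2022, §1.3 Props. 17 and 18] -/
theorem exists_traceField_eq_smul_fieldRange_of_isPrimitive_sextic (hk₀ : finrank ℚ k₀ = 2) (h6 : finrank ℚ K = 6)
    {Φ : CMType K} {φ₀ : K →+* ℂ} (hprim : IsPrimitive (ℂ ≃+* ℂ) Φ.1 φ₀) (φ : K →+* ℂ) :
    ∃ τ : ℂ ≃+* ℂ, traceField Φ = (τ • φ).toRatAlgHom.fieldRange := by
  haveI := isPretransitive_ringEquiv_complex (K := K)
  obtain ⟨σ₀, _, h⟩ := exists_traceField_eq_fieldRange_of_isPrimitive_sextic k₀ hk₀ h6 hprim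
  obtain ⟨τ, rfl⟩ := MulAction.exists_smul_eq (ℂ ≃+* ℂ) φ σ₀
  exact ⟨τ, h⟩

/-- **`K* ≅ K` for every primitive CM type of a sextic CM field containing an imaginary quadratic field** (whereas
`[K* : ℚ] = 8 > 6` when there is no such subfield, g25-#1, and `[K* : ℚ] = 2` for the imprimitive types).
[cite: DinaIonicaSijsling2022, §1.3 Props. 16 and 18] [cite: Howard2012, §3.1] -/
theorem nonempty_ringEquiv_traceField_of_isPrimitive_sextic (hk₀ : finrank ℚ k₀ = 2) (h6 : finrank ℚ K = 6)
    {Φ : CMType K} {φ₀ : K →+* ℂ} (hprim : IsPrimitive (ℂ ≃+* ℂ) Φ.1 φ₀) : Nonempty (K ≃+* traceField Φ) := by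
  obtain ⟨σ₀, hσ₀, hsp⟩ := exists_special_of_isPrimitive_sextic k₀ hk₀ h6 hprim
  exact nonempty_ringEquiv_traceField_of_special k₀ hk₀ (by omega) hσ₀ hsp

/-- Sextic `K ⊇ k₀`: for a primitive type, `τΦ = Φ ⟺ τ` fixes the special element `σ₀` — the stabiliser of a primitive
type is the stabiliser of ONE embedding (`H^r = σ H σ⁻¹` conjugate to `Gal(L/K)`, DIS Prop. 17/18).
[cite: DinaIonicaSijsling2022, §1.3 Props. 17 and 18] [cite: Howard2012, §3.1] -/
theorem exists_forall_cmTypeSmul_eq_self_iff_of_isPrimitive_sextic (hk₀ : finrank ℚ k₀ = 2) (h6 : finrank ℚ K = 6)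
    {Φ : CMType K} {φ₀ : K →+* ℂ} (hprim : IsPrimitive (ℂ ≃+* ℂ) Φ.1 φ₀) :
    ∃ σ₀ : K →+* ℂ, σ₀ ∈ Φ.1 ∧ ∀ τ : ℂ ≃+* ℂ, cmTypeSmul τ Φ = Φ ↔ τ • σ₀ = σ₀ := by
  obtain ⟨σ₀, hσ₀, hsp⟩ := exists_special_of_isPrimitive_sextic k₀ hk₀ h6 hprim
  exact ⟨σ₀, hσ₀, fun τ => cmTypeSmul_eq_self_iff_smul_special_eq k₀ hk₀ (by omega) hσ₀ hsp τ⟩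

/-- Sextic `K ⊇ k₀`: there are exactly `6` types with a special element — the six primitive types (g25-#1
`natCard_not_induced_eq_six…`), one Galois class. [cite: DinaIonicaSijsling2022, §1.3 Props. 16 and 18, §1.2 Cor. 13] -/
theorem natCard_special_eq_six (hk₀ : finrank ℚ k₀ = 2) (h6 : finrank ℚ K = 6) :
    Nat.card {Ψ : CMType K // ∃ σ₁ : K →+* ℂ, σ₁ ∈ Ψ.1 ∧
      ∀ φ ∈ Ψ.1, φ.comp (algebraMap k₀ K) = σ₁.comp (algebraMap k₀ K) → φ = σ₁} = 6 := by
  rw [natCard_special_eq_finrank k₀ hk₀ (by omega), h6]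

end Sextic

/-! ## §5 Octic CM fields containing an imaginary quadratic field: the eight special types -/

section Octic

variable [IsCMField K] (k₀ : IntermediateField ℚ K) [IsTotallyComplex k₀]

/-- **OCTIC `K ⊇ k₀`: a CM type with a special element (signature `(3, 1)`) is primitive with `[K* : ℚ] = 8` and
`K* ≅ K`** — in genus `4` these are primitive types whose reflex field is again a conjugate of `K` (cf. DIS Rem. 14 on
octic fields). [cite: Howard2012, §3.1] [cite: DinaIonicaSijsling2022, §1.2 Rem. 14] -/
theorem isPrimitive_and_finrank_traceField_of_special_octic (hk₀ : finrank ℚ k₀ = 2) (h8 : finrank ℚ K = 8)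
    {Φ : CMType K} {σ₀ : K →+* ℂ} (hσ₀ : σ₀ ∈ Φ.1)
    (hsp : ∀ φ ∈ Φ.1, φ.comp (algebraMap k₀ K) = σ₀.comp (algebraMap k₀ K) → φ = σ₀) (φ₀ : K →+* ℂ) :
    IsPrimitive (ℂ ≃+* ℂ) Φ.1 φ₀ ∧ finrank ℚ (traceField Φ) = 8 ∧ Nonempty (K ≃+* traceField Φ) :=
  ⟨isPrimitive_of_special k₀ hk₀ (by omega) hσ₀ hsp φ₀,
    (finrank_traceField_eq_finrank_of_special k₀ hk₀ (by omega) hσ₀ hsp).trans h8,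
    nonempty_ringEquiv_traceField_of_special k₀ hk₀ (by omega) hσ₀ hsp⟩

/-- Octic `K ⊇ k₀`: exactly `8` CM types have a special element, and they form one Galois class of size `8`.
[cite: Howard2012, §3.1] -/
theorem natCard_special_eq_eight (hk₀ : finrank ℚ k₀ = 2) (h8 : finrank ℚ K = 8) :
    Nat.card {Ψ : CMType K // ∃ σ₁ : K →+* ℂ, σ₁ ∈ Ψ.1 ∧
      ∀ φ ∈ Ψ.1, φ.comp (algebraMap k₀ K) = σ₁.comp (algebraMap k₀ K) → φ = σ₁} = 8 := by
  rw [natCard_special_eq_finrank k₀ hk₀ (by omega), h8]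

/-- Octic `K ⊇ k₀`: a type with a special element has the reflex degree `8` of the list `{6, 8, 12, 16}` of g25-#4 and
rank `4 ≤ Rank(Φ) ≤ 5` (g25-#5 `cmTypeRank_mem_of_finrank_traceField_eq_eight`). [cite: Howard2012, §3.1]
[cite: Dodson1987, §1.1 Thm. 1.4] -/
theorem cmTypeRank_mem_of_special_octic (hk₀ : finrank ℚ k₀ = 2) (h8 : finrank ℚ K = 8) {Φ : CMType K}
    {σ₀ : K →+* ℂ} (hσ₀ : σ₀ ∈ Φ.1)
    (hsp : ∀ φ ∈ Φ.1, φ.comp (algebraMap k₀ K) = σ₀.comp (algebraMap k₀ K) → φ = σ₀) :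
    Literature.AlgebraicGeometry.Pohlmann1968.cmTypeRank Φ = 4 ∨ Literature.AlgebraicGeometry.Pohlmann1968.cmTypeRank Φ = 5 :=
  cmTypeRank_mem_of_finrank_traceField_eq_eight Φ
    ((finrank_traceField_eq_finrank_of_special k₀ hk₀ (by omega) hσ₀ hsp).trans h8)

end Octic

end Literature.NumberTheory.ComplexMultiplication

end
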